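import Summits.AtomisticToContinuum.BoseEinsteinCondensation.Theorems.PeriodicIRBound.Negative.HardCoreScope
import Summits.AtomisticToContinuum.BoseEinsteinCondensation.Theorems.PeriodicIRBound.Negative.FreeGas
import Summits.AtomisticToContinuum.BoseEinsteinCondensation.Theorems.PeriodicIRBound.Negative.AEClass
import Summits.AtomisticToContinuum.BoseEinsteinCondensation.Theorems.BECConjugateDominationHardCoreExtensionTruncationEnergyConvergenceAll
import Summits.AtomisticToContinuum.BoseEinsteinCondensation.Theorems.BECGroundStateSOSPeriodicIRBoundClassScaling
import Summits.AtomisticToContinuum.BoseEinsteinCondensation.Theorems.BECGroundStateSOSPeriodicIRBoundTowerTransfer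
import HarnessLib

/-!
# Line `hardcore-monotone-class-uniformity` — checked skeleton for crux `PeriodicIRBound`
# (stmt-AtomisticToContinuum-3972; route `route-AtomisticToContinuum-BECGroundStateSOS`)

**v2-a1 (line lead seat a1, 2026-08-17).** Reshape of the planner's checked skeleton (commit b61a4399d1d7):
(i) the registered stubs are RESTATED OVER LANDED VOCABULARY ONLY (`NearMin/InWindow/IRIneq/IRBoundFor` of
`Negative.TwoModeStates`, `truncPotential`, `IsRepulsiveFiniteRange`), i.e. with this file's documentation defs
`HasRange/IsBddPot/ClassUniformIRBound/TowerUniformIRBound/TruncationTransfer` unfolded, so that each stub file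
`Theorems/BECGroundStateSOSPeriodicIRBound<Stub>.lean` states its registered signature verbatim without a Defs module
(the defs below are definitionally the stub statements; `PeriodicIRBound_of` type-checks by `δ`-unfolding);
(ii) the hardest stub is REDUCED TO UNIT RANGE: `stub_classUniformIR : C⁺(1)` (was `∀ R₀ > 0, C⁺(R₀)`), the
reduction being the new by-product stub `stub_classScaling : C⁺(1) ⇒ ∀ R₀ > 0, C⁺(R₀)` (class form of the scaling
covariance of Disproof §13 — the pulled-back slack `R₀⁻²δ_N` is member-independent), PROVED in the lead's folder
(`work/stubs/ClassScaling.lean`, rc 0) and landing `--supports`; (iii) composition unchanged otherwise.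
**v3-a1.** `stub_classScaling` (p136323) and `stub_towerTransfer` (p136495) LANDED and are imported; ONE `sorry` remains:
`stub_classUniformIR = C⁺(1)`, the bounded unit-range half of the crux with class-uniform data (≥ torus TL-BEC, p132197).
**v4-a1.** By-products `stub_reductionToClassUniformOne` (`C⁺(1) ⇒` the crux for every admissible `v`) and
`stub_floorOfClassUniformOne` (`C⁺(1) ⇒` torus TL-BEC for every admissible `v`) LANDED (p136757; documented in §5):
the line is COMPLETE MODULO `C⁺(1)` (tree: `periodicIRBound_iff.2 (stub_reductionToClassUniformOne h)` for any proof `h` of `C⁺(1)`).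

Crux decl `Summit.AtomisticToContinuum.BoseEinsteinCondensation.Theses.BECGroundStateSOS.PeriodicIRBound`, concluded
BY NAME by `PeriodicIRBound_of` (§3) as a closed term over the registered stubs of §2. Idea card
`Cruxes/PeriodicIRBound/Ideas/hardcore-monotone-class-uniformity.md` (round 2, ideator 5), sharpened by the triage
panel (`TRIAGE-r2-1.md` verdict + §D "Near-minimiser inheritance"; `TRIAGE-r2-2.md` sharpen 1/2): the card's γ-form
transfer and its stub `GroundOccupationTruncationLimit` (FALSE as typed at jammed densities — triage r2-1 App. C /
r2-2 §D3 — and, once guarded, resting on uniqueness of the hard-core ground state = connectivity of the dilute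
hard-sphere configuration space) are BYPASSED ENTIRELY: the transfer target `C⁺` is stated in the crux's own
near-minimiser currency with a CLASS-UNIFORM SLACK, and the hard core is reached by slack matching along the
truncation tower `min(v, M) ↑ v` at FIXED `(N, L)` — no γ normal form, no Perron–Frobenius, no configuration-space
topology.

## The line in one paragraph

`C⁺(R₀) = ClassUniformIRBound R₀`: the crux's inequality for every BOUNDED admissible potential `w` of range `≤ R₀`,
with the data `(ρ₀, C)`, the `N`-threshold AND the slack `δ_N` uniform over that class (constants native to the range /
scattering length `a(w) ≤ R₀`, never to `‖w‖₁`; Bogoliubov: `C ≍ √a ≤ √R₀`, `δ_N ≍ C√ρ/L_N` one phonon, Disproof §16).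
Given `C⁺(R₀)`, every admissible `v` of range `≤ R₀` (hard cores, non-`L¹` spikes included) inherits `IRBoundFor v`:
its truncations `v_M = min(v, M)` are bounded members of the class (`towerUniform_of_classUniform`, PROVED), and at fixed
`(N, L_N)` with `E₀(v) < ⊤` (Ruelle, eventually in `N` below `ρ₁(v)`) the LANDED fixed-volume energy convergence
`E₀(v_M) ↑ E₀(v)` (`stub_truncationEnergyConvergenceAll`, Simon's monotone form convergence + Rellich, hard cores
included) makes every `δ/2`-near-minimiser `Ψ` of `v` a `δ`-near-minimiser of `v_M` for `M ≥ M₀(δ, N)`: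
`𝓔_{v_M}[Ψ] ≤ 𝓔_v[Ψ] ≤ E₀(v) + δ/2 ≤ E₀(v_M) + δ` — so `Ψ` obeys the bound with the class constant (`stub_towerTransfer`,
stated over the weakest hypothesis the argument consumes: uniformity along the truncation TOWER of `v` only).

## Stubs (sizes) — registered by `ledger skeleton check` (v2-a1 signatures: unfolded, see §2)

* `stub_classUniformIR : C⁺(1)` (= `ClassUniformIRBound 1` unfolded) — XL: the whole infrared weight
  (formally ⊇ the bounded unit-range half of the crux, hence ≥ torus TL-BEC on that class by the kernel-checked floor
  `DifficultyFloor.stub_difficultyFloor`, p132197). THE HARDEST STUB; the end-game target for any a-native line.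
* `stub_classScaling : C⁺(1) → ∀ R₀ > 0, C⁺(R₀)` (by-product, v2-a1) — S; LANDED p136323 (class form of Disproof §13).
* `stub_towerTransfer : TruncationTransfer` (unfolded) — tower-uniform bound ⇒ `IRBoundFor v`, every admissible `v`.
  M (Lean) / S (mathematics); LANDED p136495 (wave 1) from tree facts: `stub_truncationEnergyConvergenceAll`
  (`Cruxes.HardCoreExtension.ThirdLawCurrentFloorAlt`), `periodicEnergy_truncPotential_le'` /
  `periodicEnergy_mono_of_le`, `exists_eventually_periodicGroundStateEnergy_lt_top`, `sideLength_pos_of_pos`; template: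
  `Cruxes.HardCoreExtension.NearMinTower.nearMinBEC_of_minorantTower` / `periodicBEC_of_minorantTowerBEC` (the same
  slack matching for the BEC floor predicate — the argument is predicate-agnostic).

## Disproof used (`Cruxes/PeriodicIRBound/Disproof.lean`, §1–§22; landed `Theorems/PeriodicIRBound/Negative/*`)

§1 `periodicIRBound_iff` (composition) · §5 `_false_without_nearMin`: honoured — every statement here is about
`δ`-near-minimisers, `δ` chosen after `N` (§8 `_false_without_uniformSlack`: our `δ` is `N`-dependent, uniform only
over POTENTIALS) · §6/§7 (`E₀ = ⊤` for `v ≡ 1` / jammed hard cores): the class of `C⁺` is BOUNDED so `E₀ < ⊤` there,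
and the transfer uses `ρ < ρ₁(v)` (§10 non-vacuity / Ruelle) — exactly the guard whose absence made the card's
`GroundOccupationTruncationLimit` false (triage r2-1 C, r2-2 §D3) · §9/§21 free and a.e.-free members of the class cost
nothing (`free_irIneq`: slack `4π²C√ρ/L_N`) · §13/§17: `C⁺` is NOT the refuted `PeriodicIRBoundUniformC` — `C` depends on
the range `R₀`; in-class dilations `b ≤ 1` map `(κ, ρ₀, C) ↦ (κ√b, ρ₀/b³, C√b)` (`irBoundWith_scaledPotential`, whose slack
`b⁻²δ` is already `v`-independent), no contradiction · §16 tightness: the class slack must be `≤ 4π²C√ρ/L_N` (the free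
member), consistent with one Bogoliubov phonon for interacting members · §19 `periodicIRBound_iff_split`: the
NON-INTEGRABLE HALF is what this line reduces (`nonIntegrableHalf_of`, §4) · §20/§21 not needed (no kinetic sum rule, no
a.e.-class argument). No stub is an instance of a landed `Negative/*` lemma; `ledger negatives` (BEC: BerryStiffPhaseLRO,
SwapJensen) — no overlap.
-/

noncomputable section

open MeasureTheory Filter
open scoped ENNReal NNReal

namespace Summit.AtomisticToContinuum.BoseEinsteinCondensation.Cruxes.PeriodicIRBound.HardcoreMonotoneClassUniformity

open Literature.MathematicalPhysics.QuantumManyBody.BoseGas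
open Summit.AtomisticToContinuum.BoseEinsteinCondensation.Theses.BECGroundStateSOS (PeriodicIRBound)
open Summit.AtomisticToContinuum.BoseEinsteinCondensation.Theorems.PeriodicIRBound.Negative
  (NearMin InWindow IRIneq IRBoundFor IRBoundWith irBoundFor_iff periodicIRBound_iff periodicIRBound_iff_split
    free_irIneq periodicEnergy_congr_ae periodicGroundStateEnergy_congr_ae)
open Summit.AtomisticToContinuum.BoseEinsteinCondensation.Theorems.CorrectorClosure.Negative
  (hardCore isRepulsiveFiniteRange_hardCore)

/-! ## §1 Statements -/

/-- `w` has range `≤ R₀`: `w(r) = 0` for `r > R₀` (the witness of `IsRepulsiveFiniteRange`, made explicit). -/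
def HasRange (R₀ : ℝ) (w : ℝ → ℝ≥0∞) : Prop :=
  ∀ r, R₀ < r → w r = 0

/-- `w` is a BOUNDED profile: `w ≤ M < ⊤` (the shape used by the tree's `truncationLimit_of_bounded`). -/
def IsBddPot (w : ℝ → ℝ≥0∞) : Prop :=
  ∃ M : ℝ≥0∞, M ≠ ⊤ ∧ ∀ r, w r ≤ M

/-- **`C⁺(R₀)` — the crux on the BOUNDED admissible class of range `≤ R₀`, with CLASS-UNIFORM data AND slack.**
For every window `κ > 0` there are `ρ₀, C > 0` such that for `0 < ρ < ρ₀`, eventually in `N`, ONE slack `δ = δ_N > 0`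
works for EVERY bounded admissible `w` of range `≤ R₀`: every `δ`-near-minimiser `Ψ` of the periodic `N`-body energy
of `w` on the torus of side `L_N = (N/ρ)^{1/3}` has `n_k(Ψ) ≤ C√ρ L_N/‖k‖_∞` for all `k ≠ 0`, `‖k‖_∞ ≤ κ√ρ L_N`.
The class is NOT compact and contains arbitrarily high soft spheres `M·1_{[0,R₀]}` (hard-core approximants) and
arbitrarily weak / short-range members (`a(w) → 0`, nearly free): uniformity says the constants are native to
`(a(w), R₀)` with `a(w) ≤ R₀` (Dyson-lemma format), never to `‖w‖₁` (Born format). Formally stronger than the bounded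
half of the crux; NOT the refuted `PeriodicIRBoundUniformC` (Disproof §17): `C = C(κ, R₀)`. -/
def ClassUniformIRBound (R₀ : ℝ) : Prop :=
  ∀ κ : ℝ, 0 < κ → ∃ ρ₀ : ℝ, 0 < ρ₀ ∧ ∃ C : ℝ, 0 < C ∧ ∀ ρ : ℝ, 0 < ρ → ρ < ρ₀ →
    ∀ᶠ N : ℕ in atTop, ∃ δ : ℝ≥0∞, 0 < δ ∧
      ∀ w : ℝ → ℝ≥0∞, IsRepulsiveFiniteRange w → HasRange R₀ w → IsBddPot w →
        ∀ Ψ : PeriodicTrialState N (sideLength ρ N), NearMin w ρ N δ Ψ →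
          ∀ k : Fin 3 → ℤ, InWindow κ ρ N k → IRIneq C ρ N Ψ.ψ k

/-- `C⁺` for every range. -/
def ClassUniformIRBoundAll : Prop :=
  ∀ R₀ : ℝ, 0 < R₀ → ClassUniformIRBound R₀

/-- **Tower-uniform infrared bound for ONE potential `v`** — the weakest hypothesis the transfer consumes: the
crux's data `(ρ₀, C)`, `N`-threshold and slack `δ_N` for the bounded truncations `v_M = min(v, M)`, uniform along the
tower in the sense "for the given `δ_N`, arbitrarily high levels `M` obey the bound" (`∀ M₁ ∃ M ≥ M₁`). For bounded
`v` it is implied by `IRBoundFor v` itself (`towerUniform_of_irBoundFor_of_bdd`, §4); for every `v` of range `≤ R₀`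
it is implied by `C⁺(R₀)` (`towerUniform_of_classUniform`, §3). -/
def TowerUniformIRBound (v : ℝ → ℝ≥0∞) : Prop :=
  ∀ κ : ℝ, 0 < κ → ∃ ρ₀ : ℝ, 0 < ρ₀ ∧ ∃ C : ℝ, 0 < C ∧ ∀ ρ : ℝ, 0 < ρ → ρ < ρ₀ →
    ∀ᶠ N : ℕ in atTop, ∃ δ : ℝ≥0∞, 0 < δ ∧ ∀ M₁ : ℕ, ∃ M : ℕ, M₁ ≤ M ∧
      ∀ Ψ : PeriodicTrialState N (sideLength ρ N), NearMin (truncPotential v M) ρ N δ Ψ →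
        ∀ k : Fin 3 → ℤ, InWindow κ ρ N k → IRIneq C ρ N Ψ.ψ k

/-- **The truncation transfer** (the lever): tower-uniform bound ⇒ the crux for `v`, for EVERY admissible `v`
(hard cores and non-integrable spikes included). Proof plan (all inputs in tree): fix `κ`; take `(ρ₀, C)` from the
tower bound and `ρ₁(v)` from Ruelle finiteness (`exists_eventually_periodicGroundStateEnergy_lt_top`); for
`ρ < min ρ₀ ρ₁`, eventually in `N`: `E₀(v; N, L_N) < ⊤`, `0 < L_N`, and a slack `δ` with the tower property; put
`δ₁ = min δ 1`, `ε = (δ₁/2).toReal`; `stub_truncationEnergyConvergenceAll` gives `M₀` with `E₀(v) ≤ E₀(v_M) + δ₁/2` for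
`M ≥ M₀`; pick `M ≥ M₀` in the tower; then every `δ₁/2`-near-minimiser `Ψ` of `v` satisfies
`𝓔_{v_M}[Ψ] ≤ 𝓔_v[Ψ] ≤ E₀(v) + δ₁/2 ≤ E₀(v_M) + δ₁ ≤ E₀(v_M) + δ` (`periodicEnergy_truncPotential_le'`,
`ENNReal.add_halves`), i.e. is a `δ`-near-minimiser of `v_M`, and inherits `IRIneq C ρ N Ψ.ψ k` on the window.
Verbatim the slack matching of `Cruxes.HardCoreExtension.NearMinTower.nearMinBEC_of_minorantTower` with the BEC-floor
predicate replaced by the infrared inequality. -/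
def TruncationTransfer : Prop :=
  ∀ v : ℝ → ℝ≥0∞, IsRepulsiveFiniteRange v → TowerUniformIRBound v → IRBoundFor v

/-! ## §2 The registered stubs (v2-a1: signatures over landed vocabulary only; v3-a1: two of three landed) -/

/-- **stub_classUniformIR** (XL; THE HARDEST STUB — the infrared content, ≥ torus TL-BEC on the bounded unit-range
class by the floor p132197): `C⁺(1)`, i.e. `ClassUniformIRBound 1` UNFOLDED (`HasRange 1 w`, `IsBddPot w` spelled
out; definitionally `ClassUniformIRBound 1`, `classUniformIRBound_one_iff`). Unit range is WLOG by the registered,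
proved by-product `stub_classScaling` (class form of Disproof §13). Expected TRUE (Bogoliubov / Gavoret–Nozières
`n_p ≈ √(πρa)·L/(2π‖k‖)`, `a ≤ 1`; free and a.e.-free members with any `C` at slack `4π²C√ρ/L_N`, Disproof
§9/§16/§21); every proof must keep its constants `a`-native (LY1998 / LSSY2005 Thm 2.4 Dyson-lemma format). -/
theorem stub_classUniformIR :
    ∀ κ : ℝ, 0 < κ → ∃ ρ₀ : ℝ, 0 < ρ₀ ∧ ∃ C : ℝ, 0 < C ∧ ∀ ρ : ℝ, 0 < ρ → ρ < ρ₀ →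
      ∀ᶠ N : ℕ in atTop, ∃ δ : ℝ≥0∞, 0 < δ ∧
        ∀ w : ℝ → ℝ≥0∞, IsRepulsiveFiniteRange w → (∀ r, 1 < r → w r = 0) →
          (∃ M : ℝ≥0∞, M ≠ ⊤ ∧ ∀ r, w r ≤ M) →
          ∀ Ψ : PeriodicTrialState N (sideLength ρ N), NearMin w ρ N δ Ψ →
            ∀ k : Fin 3 → ℤ, InWindow κ ρ N k → IRIneq C ρ N Ψ.ψ k := by
  sorry

/-! ### Landed stubs (v3-a1): imported, not restated

* `stub_classScaling` — `Theorems/BECGroundStateSOSPeriodicIRBoundClassScaling.lean` (p136323, ACCEPTED, commit de0766848b16):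
  `C⁺(1) ⇒ ∀ R₀ > 0, C⁺(R₀)` (class form of Disproof §13; the pulled-back slack `R₀⁻²δ_N` is member-independent).
* `stub_towerTransfer` — `Theorems/BECGroundStateSOSPeriodicIRBoundTowerTransfer.lean` (p136495, ACCEPTED, commit 1fac7ff806c1):
  the truncation transfer `TruncationTransfer` (unfolded), slack matching along `min(v, M) ↑ v` at fixed `(N, L_N)` over
  `stub_truncationEnergyConvergenceAll` + Ruelle finiteness; wave-1 stub-worker of this seat.
-/

/-- The hardest stub's signature IS `ClassUniformIRBound 1` (definitional unfolding). -/
theorem classUniformIRBound_one_iff :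
    ClassUniformIRBound 1 ↔
      ∀ κ : ℝ, 0 < κ → ∃ ρ₀ : ℝ, 0 < ρ₀ ∧ ∃ C : ℝ, 0 < C ∧ ∀ ρ : ℝ, 0 < ρ → ρ < ρ₀ →
        ∀ᶠ N : ℕ in atTop, ∃ δ : ℝ≥0∞, 0 < δ ∧
          ∀ w : ℝ → ℝ≥0∞, IsRepulsiveFiniteRange w → (∀ r, 1 < r → w r = 0) →
            (∃ M : ℝ≥0∞, M ≠ ⊤ ∧ ∀ r, w r ≤ M) →
            ∀ Ψ : PeriodicTrialState N (sideLength ρ N), NearMin w ρ N δ Ψ →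
              ∀ k : Fin 3 → ℤ, InWindow κ ρ N k → IRIneq C ρ N Ψ.ψ k :=
  Iff.rfl

/-- The transfer stub's signature IS `TruncationTransfer` (definitional unfolding). -/
theorem truncationTransfer_iff :
    TruncationTransfer ↔
      ∀ v : ℝ → ℝ≥0∞, IsRepulsiveFiniteRange v →
        (∀ κ : ℝ, 0 < κ → ∃ ρ₀ : ℝ, 0 < ρ₀ ∧ ∃ C : ℝ, 0 < C ∧ ∀ ρ : ℝ, 0 < ρ → ρ < ρ₀ →
          ∀ᶠ N : ℕ in atTop, ∃ δ : ℝ≥0∞, 0 < δ ∧ ∀ M₁ : ℕ, ∃ M : ℕ, M₁ ≤ M ∧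
            ∀ Ψ : PeriodicTrialState N (sideLength ρ N), NearMin (truncPotential v M) ρ N δ Ψ →
              ∀ k : Fin 3 → ℤ, InWindow κ ρ N k → IRIneq C ρ N Ψ.ψ k) →
        IRBoundFor v :=
  Iff.rfl

/-- `C⁺` at every range from the hardest stub and the scaling by-product (the two registered statements,
hypotheses form). -/
theorem classUniformIRBoundAll_of (h1 : ClassUniformIRBound 1)
    (hsc : ClassUniformIRBound 1 → ∀ R₀ : ℝ, 0 < R₀ → ClassUniformIRBound R₀) : ClassUniformIRBoundAll :=
  hsc h1

/-! ## §3 Composition (real proofs; no `sorry` below this line) -/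

/-- Truncations of an admissible potential are admissible (measurable, same range). -/
theorem isRepulsiveFiniteRange_truncPotential {v : ℝ → ℝ≥0∞} (hv : IsRepulsiveFiniteRange v) (M : ℕ) :
    IsRepulsiveFiniteRange (truncPotential v M) := by
  refine ⟨measurable_truncPotential hv.1 M, ?_⟩
  obtain ⟨R₀, hR₀⟩ := hv.2
  exact ⟨R₀, fun r hr => by simp [truncPotential, hR₀ r hr]⟩

/-- Truncation does not enlarge the range. -/
theorem hasRange_truncPotential {R₀ : ℝ} {v : ℝ → ℝ≥0∞} (hR : HasRange R₀ v) (M : ℕ) :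
    HasRange R₀ (truncPotential v M) :=
  fun r hr => by simp [truncPotential, hR r hr]

/-- Truncations are bounded (`min(v, M) ≤ M < ⊤`). -/
theorem isBddPot_truncPotential (v : ℝ → ℝ≥0∞) (M : ℕ) : IsBddPot (truncPotential v M) :=
  ⟨M, ENNReal.natCast_ne_top M, fun _ => min_le_right _ _⟩

/-- **`C⁺(R₀)` ⇒ the tower-uniform bound for every admissible `v` of range `≤ R₀`** (every truncation `min(v, M)` is
a bounded admissible member of the class, so the class data serve the whole tower, at every level `M`). -/
theorem towerUniform_of_classUniform {R₀ : ℝ} (h : ClassUniformIRBound R₀) {v : ℝ → ℝ≥0∞}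
    (hv : IsRepulsiveFiniteRange v) (hR : HasRange R₀ v) : TowerUniformIRBound v := by
  intro κ hκ
  obtain ⟨ρ₀, hρ₀, C, hC, hW⟩ := h κ hκ
  refine ⟨ρ₀, hρ₀, C, hC, fun ρ hρ hρρ₀ => ?_⟩
  filter_upwards [hW ρ hρ hρρ₀] with N ⟨δ, hδ, hN⟩
  exact ⟨δ, hδ, fun M₁ => ⟨M₁, le_rfl, fun Ψ hΨ k hk =>
    hN (truncPotential v M₁) (isRepulsiveFiniteRange_truncPotential hv M₁) (hasRange_truncPotential hR M₁)
      (isBddPot_truncPotential v M₁) Ψ hΨ k hk⟩⟩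

/-- **The crux for every admissible potential from the two stubs' statements** (hypotheses form; conclusion kept in
the unfolded shape `∀ v admissible, IRBoundFor v` so that only `PeriodicIRBound_of` concludes the crux decl by name). -/
theorem irBoundFor_all_of (hC : ClassUniformIRBoundAll) (hT : TruncationTransfer) :
    ∀ v : ℝ → ℝ≥0∞, IsRepulsiveFiniteRange v → IRBoundFor v := by
  intro v hv
  obtain ⟨R, hR, hvR⟩ := hv.exists_pos_range
  exact hT v hv (towerUniform_of_classUniform (hC R hR) hv hvR)

/-- **The skeleton theorem: the crux `PeriodicIRBound`, concluded BY NAME**, as a closed term over the two registered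
stubs (`periodicIRBound_iff`: the crux is `∀ v admissible, IRBoundFor v`). -/
theorem PeriodicIRBound_of : PeriodicIRBound :=
  periodicIRBound_iff.2
    (irBoundFor_all_of (classUniformIRBoundAll_of stub_classUniformIR stub_classScaling) stub_towerTransfer)

/-! ## §4 By-products and consistency checks (sorry-free; not used by `PeriodicIRBound_of`) -/

/-- The class shrinks with the range bound: `C⁺` is antitone in `R₀`. -/
theorem classUniformIRBound_anti {R₀ R₁ : ℝ} (h : ClassUniformIRBound R₀) (hR : R₁ ≤ R₀) :
    ClassUniformIRBound R₁ := by
  intro κ hκ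
  obtain ⟨ρ₀, hρ₀, C, hC, hW⟩ := h κ hκ
  refine ⟨ρ₀, hρ₀, C, hC, fun ρ hρ hρρ₀ => ?_⟩
  filter_upwards [hW ρ hρ hρρ₀] with N ⟨δ, hδ, hN⟩
  exact ⟨δ, hδ, fun w hw hwR hwb => hN w hw (fun r hr => hwR r (hR.trans_lt hr)) hwb⟩

/-- **Consistency of the transfer hypothesis on BOUNDED potentials**: there `TowerUniformIRBound v` is implied by the
crux's own `IRBoundFor v` (the tower is eventually constant, `min(v, M) = v` for `M ≥ sup v`), so `stub_towerTransfer`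
asks nothing beyond the crux where truncation is idle, and its content is exactly the unbounded (hard-core /
non-integrable) members. -/
theorem towerUniform_of_irBoundFor_of_bdd {v : ℝ → ℝ≥0∞} (hb : IsBddPot v) (h : IRBoundFor v) :
    TowerUniformIRBound v := by
  obtain ⟨Mb, hMb, hvle⟩ := hb
  obtain ⟨n, hn⟩ := ENNReal.exists_nat_gt hMb
  intro κ hκ
  obtain ⟨ρ₀, hρ₀, C, hC, hW⟩ := h κ hκ
  refine ⟨ρ₀, hρ₀, C, hC, fun ρ hρ hρρ₀ => ?_⟩
  filter_upwards [hW ρ hρ hρρ₀] with N ⟨δ, hδ, hN⟩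
  refine ⟨δ, hδ, fun M₁ => ⟨max n M₁, le_max_right _ _, fun Ψ hΨ k hk => hN Ψ ?_ k hk⟩⟩
  have htr : truncPotential v (max n M₁) = v := by
    funext r
    refine min_eq_left ((hvle r).trans (hn.le.trans ?_))
    exact_mod_cast le_max_left n M₁
  simpa [NearMin, htr] using hΨ

/-- **What the line reduces: the NON-INTEGRABLE HALF of the crux** (`periodicIRBound_iff_split`, Disproof §19 — the
half no earlier line reduced: fsum S6 `NonIntegrableHalf`, linear 6b `HardCoreWagnerFeynmanBound`, stmt-11844-type
Dyson dressing) is a corollary of `C⁺` and the transfer; in particular the hard core of radius `1`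
(`hardCore_in_scope`) is covered. -/
theorem nonIntegrableHalf_of (hC : ClassUniformIRBoundAll) (hT : TruncationTransfer) :
    (∀ v : ℝ → ℝ≥0∞, IsRepulsiveFiniteRange v → (∫⁻ x : Space, v ‖x‖) = ⊤ → IRBoundFor v) ∧
      IRBoundFor hardCore :=
  ⟨fun v hv _ => irBoundFor_all_of hC hT v hv, irBoundFor_all_of hC hT hardCore isRepulsiveFiniteRange_hardCore⟩

/-- **Tower form suffices** (fallback shape of the hardest stub, recorded for the planners/disprover): the composition
consumes only `TowerUniformIRBound v` for each admissible `v` — for BOUNDED `v` this is the crux's own `IRBoundFor v` with NO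
uniformity (`towerUniform_of_irBoundFor_of_bdd`), for unbounded `v` uniformity along ITS truncations only. Should the full
class-uniformity of `C⁺(1)` ever be refuted by a family that is not a truncation tower, the line survives on this statement
(conclusion kept unfolded; the crux by name is `periodicIRBound_iff.2` of it). [folklore] -/
theorem irBoundFor_all_of_tower (h : ∀ v : ℝ → ℝ≥0∞, IsRepulsiveFiniteRange v → TowerUniformIRBound v) :
    ∀ v : ℝ → ℝ≥0∞, IsRepulsiveFiniteRange v → IRBoundFor v :=
  fun v hv => stub_towerTransfer v hv (h v hv)

/-- **Consistency of the CLASS-UNIFORM SLACK at the free corner of the class** (v4-a1; a guard for the disprover):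
every admissible `w` of scattering length ZERO (equivalently `w(|·|) = 0` a.e., e.g. `w = M·1_S` with `S` null — these
are class members for every range) satisfies the conclusion of `C⁺` with ANY `C > 0`, NO density or `N` threshold, and the
explicit member-independent slack `δ_N = 4π²C√ρ/L_N` (the one-phonon scale of Disproof §16, which is also the LARGEST
admissible slack for the free member): `NearMin w = NearMin 0` by the a.e.-class invariance of the energy (Disproof §21),
then the kinetic Markov bound `free_irIneq` (§9). So the uniform-slack clause of `C⁺(1)` costs nothing where `a(w) = 0`;
its content is the interacting members, uniformly down to `a → 0⁺`. [folklore] -/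
theorem classUniform_freeCorner {κ ρ C : ℝ} (hρ : 0 < ρ) (hC : 0 < C) :
    ∀ᶠ N : ℕ in atTop, ∀ w : ℝ → ℝ≥0∞, IsRepulsiveFiniteRange w → scatteringLength w = 0 →
      ∀ Ψ : PeriodicTrialState N (sideLength ρ N),
        NearMin w ρ N (ENNReal.ofReal (4 * Real.pi ^ 2 * C * Real.sqrt ρ / sideLength ρ N)) Ψ →
          ∀ k : Fin 3 → ℤ, InWindow κ ρ N k → IRIneq C ρ N Ψ.ψ k := by
  filter_upwards [eventually_gt_atTop 0] with N hN w hw ha Ψ hΨ k hk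
  obtain ⟨R₀, hR₀⟩ := hw.2
  have hae : ∀ᵐ x : Space, w ‖x‖ = (0 : ℝ → ℝ≥0∞) ‖x‖ := by
    simpa using LSSY2005_zeroScatteringLength_holds w R₀ hw.1 hR₀ ha
  have hΨ0 : NearMin 0 ρ N (ENNReal.ofReal (4 * Real.pi ^ 2 * C * Real.sqrt ρ / sideLength ρ N)) Ψ := by
    unfold NearMin at hΨ ⊢
    rwa [periodicEnergy_congr_ae hae Ψ, periodicGroundStateEnergy_congr_ae hae] at hΨ
  exact free_irIneq hρ hC hN Ψ hΨ0 hk.1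

/-! ## §5 Registered by-products (v3-a1) — LANDED (v4-a1), module
`Summits.AtomisticToContinuum.BoseEinsteinCondensation.Theorems.BECGroundStateSOSPeriodicIRBoundOfClassUniform`
(p136757, ACCEPTED, commit 7fe405d91790; not imported here only to keep this workfile independent of the farm's build lag —
its content equals §3's composition):

* `stub_reductionToClassUniformOne : C⁺(1) → ∀ v, IsRepulsiveFiniteRange v → IRBoundFor v` — the crux (unfolded; by name
  `periodicIRBound_iff.2 (stub_reductionToClassUniformOne h)`) from `C⁺(1)` ALONE, every admissible `v`, hard cores included
  (in particular the sibling line `two-sector-gd-transfer`'s unreduced `stub_nonIntegrableHalf` follows from `C⁺(1)`);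
* `stub_floorOfClassUniformOne : C⁺(1) → ∀ v, IsRepulsiveFiniteRange v → (torus BEC of the δ-near-minimisers, n₀ ≥ cN, at all
  small ρ, eventually in N)` — the FLOOR of the residual (≥ the summit conjunct in periodic form on the whole admissible class).
-/

end Summit.AtomisticToContinuum.BoseEinsteinCondensation.Cruxes.PeriodicIRBound.HardcoreMonotoneClassUniformity

end
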